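import Summits.Ventures.YMGap.Thresholds.OneLinkRemainderWords
import Summits.Ventures.YMGap.Thresholds.OneLinkCubicWords
import HarnessLib

/-!
# Venture YMGap — the one-link modulus beyond first order, part 12b: smoothness of the composite word shapes of the cubic
# remainder, and `tr(BBᴴ) = ‖B‖_F²`

HONEST FRAMING: venture file of the cell `pub-ymgap` (QuantumFields programme), strong-coupling LATTICE bookkeeping for `SU(N)`
lattice Yang–Mills; nothing about the continuum or the mass gap in the Clay sense.  Pure matrix calculus («F5», part 2b, of the cell
note `HOME/p2/ONE-LINK-HIERARCHY.md` §4 (4.6)); no measure, no number of record.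

WHAT.  `trace_mul_conjTranspose_self` (`tr(BBᴴ) = ‖B‖_F²` as a complex number), `norm_eta_frob`
(`‖κ tr(BBᴴ) − c conj tr(BBᴴ)‖ = (κ − c)‖B‖_F²`), and smoothness of `Re[tr(QM₁QM₂)(κ tr(QM) − c conj tr(QM))]`, `Re[tr(QM) ζ]`,
`Im tr(QB)·Im(tr(QB)tr(QΔ))` and of the whole eight-term polynomial `c₃'` of `OneLinkRemainderIdentity` (`contDiff_c3poly`) — the
inputs of the term-by-term derivative of `c₃'` in `OneLinkRemainderGradient`.

References: cell note `HOME/p2/ONE-LINK-HIERARCHY.md` §3–§4; `HOME/p2/hier/LEAN-SPEC-REMAINING.md` F5.2b.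
-/

noncomputable section

open scoped Matrix ComplexConjugate BigOperators
open Matrix Complex Finset
open Literature.MathematicalPhysics.QuantumFieldTheory
open Literature.MathematicalPhysics.QuantumFieldTheory.SUNBakryEmery

namespace Summit.Ventures.YMGap.OneLinkEigen

variable {N : ℕ}

/-- `tr(B Bᴴ) = ‖B‖_F²` (as a complex number). [folklore] -/
theorem trace_mul_conjTranspose_self (B : Matrix (Fin N) (Fin N) ℂ) :
    (B * Bᴴ).trace = ((frobNorm B ^ 2 : ℝ) : ℂ) := by
  have hre : (B * Bᴴ).trace.re = frobNorm B ^ 2 := by rw [frobNorm_sq_eq_re_trace, trace_mul_comm]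
  have him : (B * Bᴴ).trace.im = 0 := by
    have h : (starRingEnd ℂ) (B * Bᴴ).trace = (B * Bᴴ).trace := by
      rw [← star_def, ← trace_conjTranspose, conjTranspose_mul, conjTranspose_conjTranspose]
    exact Complex.conj_eq_iff_im.1 h
  exact Complex.ext (by rw [hre, ofReal_re]) (by rw [him, ofReal_im])

/-- `‖κ ζ_B − c conj ζ_B‖ = (κ − c)‖B‖_F²` for `ζ_B = tr(BBᴴ)` and `c ≤ κ`. [folklore] -/
theorem norm_eta_frob (B : Matrix (Fin N) (Fin N) ℂ) {κ c : ℝ} (hcκ : c ≤ κ) :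
    ‖(κ : ℂ) * (B * Bᴴ).trace - (c : ℂ) * (starRingEnd ℂ) (B * Bᴴ).trace‖ = (κ - c) * frobNorm B ^ 2 := by
  rw [trace_mul_conjTranspose_self, Complex.conj_ofReal, ← ofReal_mul, ← ofReal_mul, ← ofReal_sub, Complex.norm_real,
    Real.norm_of_nonneg (by nlinarith [sq_nonneg (frobNorm B)])]
  ring

section Calc

open scoped Matrix.Norms.Frobenius ContDiff Topology

/-! ### Smoothness of the composite word shapes -/

/-- `Q ↦ Re[tr(QM₁QM₂)(κ tr(QM) − c conj tr(QM))]` is smooth. [folklore] -/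
theorem contDiff_quad_eta (κ c : ℝ) (M₁ M₂ M : Matrix (Fin N) (Fin N) ℂ) :
    ContDiff ℝ ∞ fun Q : Matrix (Fin N) (Fin N) ℂ =>
      ((Q * M₁ * Q * M₂).trace * ((κ : ℂ) * (Q * M).trace - (c : ℂ) * (starRingEnd ℂ) (Q * M).trace)).re := by
  have hF : (fun Q : Matrix (Fin N) (Fin N) ℂ =>
        ((Q * M₁ * Q * M₂).trace * ((κ : ℂ) * (Q * M).trace - (c : ℂ) * (starRingEnd ℂ) (Q * M).trace)).re) =
      fun Q => (κ - c) * ((Q * M₁ * Q * M₂).trace.re * (Q * M).trace.re)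
        + (-(κ + c)) * ((Q * M₁ * Q * M₂).trace.im * (Q * M).trace.im) := by
    funext Q
    simp only [mul_re, sub_re, sub_im, mul_im, conj_re, conj_im, ofReal_re, ofReal_im]
    ring
  rw [hF]
  exact (contDiff_const.mul ((contDiff_reTrQuad M₁ M₂).mul (contDiff_reTrMul M))).add
    (contDiff_const.mul ((contDiff_imTrQuad M₁ M₂).mul (contDiff_imTrMul M)))

/-- `Q ↦ Re[tr(QM) ζ]` is smooth. [folklore] -/
theorem contDiff_lin_const (M : Matrix (Fin N) (Fin N) ℂ) (ζ : ℂ) :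
    ContDiff ℝ ∞ fun Q : Matrix (Fin N) (Fin N) ℂ => ((Q * M).trace * ζ).re := by
  have hF : (fun Q : Matrix (Fin N) (Fin N) ℂ => ((Q * M).trace * ζ).re) =
      fun Q => ζ.re * (Q * M).trace.re + (-ζ.im) * (Q * M).trace.im := by
    funext Q; simp only [mul_re]; ring
  rw [hF]
  exact (contDiff_const.mul (contDiff_reTrMul M)).add (contDiff_const.mul (contDiff_imTrMul M))

/-- `Q ↦ Im tr(QB) · Im(tr(QB) tr(QΔ))` is smooth. [folklore] -/
theorem contDiff_im_mul_imProd (B Δ : Matrix (Fin N) (Fin N) ℂ) :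
    ContDiff ℝ ∞ fun Q : Matrix (Fin N) (Fin N) ℂ => (Q * B).trace.im * ((Q * B).trace * (Q * Δ).trace).im := by
  have hF : (fun Q : Matrix (Fin N) (Fin N) ℂ => (Q * B).trace.im * ((Q * B).trace * (Q * Δ).trace).im) =
      fun Q => (Q * B).trace.im * ((Q * B).trace.re * (Q * Δ).trace.im + (Q * B).trace.im * (Q * Δ).trace.re) := by
    funext Q; simp only [mul_im]
  rw [hF]
  exact (contDiff_imTrMul B).mul (((contDiff_reTrMul B).mul (contDiff_imTrMul Δ)).add
    ((contDiff_imTrMul B).mul (contDiff_reTrMul Δ)))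

/-- The eight-term polynomial `c₃'` is smooth. [folklore] -/
theorem contDiff_c3poly (N : ℕ) (B Δ : Matrix (Fin N) (Fin N) ℂ) :
    ContDiff ℝ ∞ fun Q : Matrix (Fin N) (Fin N) ℂ =>
      ((N : ℝ) ^ 2 / (4 * ((N : ℝ) ^ 2 - 4))) / 2 *
          ((Q * B * Q * Δ * Q * B).trace.re + (Q * B * Q * B * Q * Δ).trace.re)
        - ((N : ℝ) ^ 2 / (4 * ((N : ℝ) ^ 2 - 4))) / 2 *
          ((Q * (B * Bᴴ * Δ)).trace.re + (Q * (Δ * Bᴴ * B)).trace.re)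
        + 2 * ((N : ℝ) ^ 2 / (4 * ((N : ℝ) ^ 2 - 4))) / N * (Q * B).trace.im * (Q * Δ * Q * B).trace.im
        - 1 / 2 * ((Q * B * Q * B).trace *
            ((((N : ℝ) / (2 * ((N : ℝ) ^ 2 - 4)) : ℝ) : ℂ) * (Q * Δ).trace
              - ((1 / (4 * (N : ℝ)) : ℝ) : ℂ) * (starRingEnd ℂ) (Q * Δ).trace)).re
        - 1 / 2 * ((Q * Δ * Q * B).trace *
            ((((N : ℝ) / (2 * ((N : ℝ) ^ 2 - 4)) : ℝ) : ℂ) * (Q * B).trace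
              - ((1 / (4 * (N : ℝ)) : ℝ) : ℂ) * (starRingEnd ℂ) (Q * B).trace)).re
        + 1 / 2 * ((Q * Δ).trace *
            ((((N : ℝ) / (2 * ((N : ℝ) ^ 2 - 4)) : ℝ) : ℂ) * (B * Bᴴ).trace
              - ((1 / (4 * (N : ℝ)) : ℝ) : ℂ) * (starRingEnd ℂ) (B * Bᴴ).trace)).re
        + 1 / 2 * ((Q * B).trace *
            ((((N : ℝ) / (2 * ((N : ℝ) ^ 2 - 4)) : ℝ) : ℂ) * (Δ * Bᴴ).trace
              - ((1 / (4 * (N : ℝ)) : ℝ) : ℂ) * (starRingEnd ℂ) (Δ * Bᴴ).trace)).re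
        - 2 * ((N : ℝ) / (2 * ((N : ℝ) ^ 2 - 4))) / N *
          (Q * B).trace.im * ((Q * B).trace * (Q * Δ).trace).im := by
  set κw : ℝ := (N : ℝ) ^ 2 / (4 * ((N : ℝ) ^ 2 - 4)) with hκw
  set κt : ℝ := (N : ℝ) / (2 * ((N : ℝ) ^ 2 - 4)) with hκt
  set c : ℝ := 1 / (4 * (N : ℝ)) with hc
  have h1 := (contDiff_reTrCubic (N := N) B Δ B).add (contDiff_reTrCubic (N := N) B B Δ)
  have h2 := (contDiff_reTrMul (N := N) (B * Bᴴ * Δ)).add (contDiff_reTrMul (N := N) (Δ * Bᴴ * B))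
  have h3 := (contDiff_imTrMul (N := N) B).mul (contDiff_imTrQuad (N := N) Δ B)
  have h4 := contDiff_quad_eta (N := N) κt c B B Δ
  have h5 := contDiff_quad_eta (N := N) κt c Δ B B
  have h6 := contDiff_lin_const (N := N) Δ ((κt : ℂ) * (B * Bᴴ).trace - (c : ℂ) * (starRingEnd ℂ) (B * Bᴴ).trace)
  have h7 := contDiff_lin_const (N := N) B ((κt : ℂ) * (Δ * Bᴴ).trace - (c : ℂ) * (starRingEnd ℂ) (Δ * Bᴴ).trace)
  have h8 := contDiff_im_mul_imProd (N := N) B Δ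
  have hG : (fun Q : Matrix (Fin N) (Fin N) ℂ =>
      κw / 2 * ((Q * B * Q * Δ * Q * B).trace.re + (Q * B * Q * B * Q * Δ).trace.re)
        - κw / 2 * ((Q * (B * Bᴴ * Δ)).trace.re + (Q * (Δ * Bᴴ * B)).trace.re)
        + 2 * κw / N * (Q * B).trace.im * (Q * Δ * Q * B).trace.im
        - 1 / 2 * ((Q * B * Q * B).trace * ((κt : ℂ) * (Q * Δ).trace - (c : ℂ) * (starRingEnd ℂ) (Q * Δ).trace)).re
        - 1 / 2 * ((Q * Δ * Q * B).trace * ((κt : ℂ) * (Q * B).trace - (c : ℂ) * (starRingEnd ℂ) (Q * B).trace)).re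
        + 1 / 2 * ((Q * Δ).trace * ((κt : ℂ) * (B * Bᴴ).trace - (c : ℂ) * (starRingEnd ℂ) (B * Bᴴ).trace)).re
        + 1 / 2 * ((Q * B).trace * ((κt : ℂ) * (Δ * Bᴴ).trace - (c : ℂ) * (starRingEnd ℂ) (Δ * Bᴴ).trace)).re
        - 2 * κt / N * (Q * B).trace.im * ((Q * B).trace * (Q * Δ).trace).im) =
      fun Q => (κw / 2) * ((Q * B * Q * Δ * Q * B).trace.re + (Q * B * Q * B * Q * Δ).trace.re)
        + (-(κw / 2)) * ((Q * (B * Bᴴ * Δ)).trace.re + (Q * (Δ * Bᴴ * B)).trace.re)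
        + (2 * κw / N) * ((Q * B).trace.im * (Q * Δ * Q * B).trace.im)
        + (-(1 / 2)) * ((Q * B * Q * B).trace * ((κt : ℂ) * (Q * Δ).trace - (c : ℂ) * (starRingEnd ℂ) (Q * Δ).trace)).re
        + (-(1 / 2)) * ((Q * Δ * Q * B).trace * ((κt : ℂ) * (Q * B).trace - (c : ℂ) * (starRingEnd ℂ) (Q * B).trace)).re
        + (1 / 2) * ((Q * Δ).trace * ((κt : ℂ) * (B * Bᴴ).trace - (c : ℂ) * (starRingEnd ℂ) (B * Bᴴ).trace)).re
        + (1 / 2) * ((Q * B).trace * ((κt : ℂ) * (Δ * Bᴴ).trace - (c : ℂ) * (starRingEnd ℂ) (Δ * Bᴴ).trace)).re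
        + (-(2 * κt / N)) * ((Q * B).trace.im * ((Q * B).trace * (Q * Δ).trace).im) := by
    funext Q; ring
  rw [hG]
  exact (((((((contDiff_const.mul h1).add (contDiff_const.mul h2)).add (contDiff_const.mul h3)).add
    (contDiff_const.mul h4)).add (contDiff_const.mul h5)).add (contDiff_const.mul h6)).add (contDiff_const.mul h7)).add
    (contDiff_const.mul h8)

end Calc

end Summit.Ventures.YMGap.OneLinkEigen
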